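import Summits.AtomisticToContinuum.FouriersLaw.Theorems.BondHeatUncertaintyLightConeBondHeatWeightedBalance
import Summits.AtomisticToContinuum.FouriersLaw.Theorems.BondHeatUncertaintyLightConeBondHeatGreenKuboDip
import Summits.AtomisticToContinuum.FouriersLaw.Theorems.OddSectorIrreversibilitySubBallisticWindowRampCorrector

/-!
# The tent (block-averaging) reduction of the single-bond heat variance

Support file for item `stmt-AtomisticToContinuum-9123` (`BondHeatUncertainty.LightConeBondHeat`, (S_lc): the
`N`-uniform light-cone `√t`-law `V_N(b,t) ≤ A√t`, `1 ≤ t ≤ aN`, of the equilibrium bond-heat variance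
`V_N(b,t) = 2∫₀ᵗ (t-s) C_N(b,s) ds`, `C_N(b,s) = ∫ j_b · P_s j_b dμ_T`), second half of the BULK-BOND reduction.  The
pathwise tent splitting of `…LightConeBondHeatWeightedBalance` — `∫₀ᵗ j_{b₀} = (L+1)⁻¹ ∫₀ᵗ J + ΔW` with the block current
`J = ∑_{b₀ ≤ k ≤ b₀+L} j_k` and the tent-weighted energy `W` — is squared and integrated against the stationary path law
`μ_T ⊗ W` of the constructed flow (`V_N(b,t) = E[(∫₀ᵗ j_b(z_s) ds)²]`, `…LightConeBondHeatGreenKuboDip`):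

* `pinnedChain_heatVar_le_of_pathwise_split` — generic: any pathwise splitting `∫₀ᵗ f = c∫₀ᵗ J + ΔW` with
  `f, J, W ∈ L²(μ_T)` gives `V_f(t) ≤ 2c² V_J(t) + 8 ∫ (W - m)² dμ_T` for every centring constant `m`
  (`V_g(t) = 2∫₀ᵗ (t-s) ∫ g · P_s g dμ_T ds`);
* `pinnedChain_integrable_sq_blockSum`, `pinnedChain_integrable_sq_tentEnergy` (+ continuity and exponential-class
  bounds) — the block current and the tent energy are honest `L²(μ_T)` observables;
* **`pinnedChain_bondHeatVar_le_tent`** — `V_N(b₀,t) ≤ (2/(L+1)²) V_N^J(t) + 8 ∫ (W - m)² dμ_T` whenever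
  `b₀ + L + 1 < N`, `t ≥ 0`;
* **`pinnedChain_bondHeatVar_le_tent_abs`** — hence `V_N(b₀,t) ≤ (4t/(L+1)²) ∫₀ᵗ |K_J(s)| ds + 8 ∫ (W - m)² dμ_T`,
  `K_J(s) = ∫ J · P_s J dμ_T`.

Reading (what a bulk-bond proof of (S_lc), or of any windowed law `V ≤ B t^θ`, `θ < 1`, sufficient for the NonBallistic
rung by `…LightConeBondHeatWindowedTransfer`, has to supply, `N`-uniformly): (a) STATICS — `inf_m ∫ (W - m)² dμ_T ≤ c·L`
for the tent energy of `L` consecutive interior sites (extensivity of energy fluctuations in the 1-D Gibbs state;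
provable in principle, cf. the `N`-uniform block-current statics `SubBallisticWindow.StaticCurrentBound`); (b) DYNAMICS
— `∫₀ᵗ |K_J(s)| ds ≤ (L+1) k(t)` with `k(t) = O(t^{1-δ})`, `δ > 0` (absolute time-decorrelation of the block current
per unit length: the open core, an equilibrium mixing statement for the anharmonic bulk); then `L + 1 ≍ √(t k(t)/c)`
gives `V_N(b₀,t) = O(√(c t k(t)))` (`θ = 1 - δ/2`; Edwards–Wilkinson `√t` iff `k` bounded).  Statics alone
(`k(t) ≤ ⟨J²⟩_T t/(L+1) = O(t)`) return exactly the ballistic size `θ = 1`, where the transfer inequality gives nothing.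
Nothing here closes an item.
-/

noncomputable section

open MeasureTheory Filter Topology Set intervalIntegral
open scoped NNReal ENNReal

namespace Summit.AtomisticToContinuum.FouriersLaw.Theorems.LightConeBondHeat

open Literature.MathematicalPhysics.KineticTheory.HeatConduction
open Literature.MathematicalPhysics.KineticTheory Literature.Probability.Process OscillatorChain
open Summit.AtomisticToContinuum.FouriersLaw.Theorems.SubBallisticWindow.Negative.ClosedFlow
open Summit.AtomisticToContinuum.FouriersLaw.Theorems.SubdiffusiveBondHeat

/-! ### The tent reduction at the kernel level -/

section Generic

variable {ω₂ lam β γ : ℝ} (hω : 0 < ω₂) (hl : 0 ≤ lam) (hβ : 0 < β) (hγ : 0 < γ) {N : ℕ} (hN : 0 < N)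
  {T : ℝ} (hT : 0 < T)
include hω hl hβ hγ hN hT

/-- **Second moments of a pathwise splitting** (generic): if along the stationary constructed flow `z_s = Φ_s(x,B)`,
`x ∼ μ_T`, the time integral of `f` splits as `∫₀ᵗ f(z_s) ds = c ∫₀ᵗ J(z_s) ds + (W(z_t) - W(x))` for every initial
point and every Brownian pair, with `f, J, W ∈ L²(μ_T)` measurable, then for every centring constant `m`
`2∫₀ᵗ (t-s) K_f(s) ds ≤ 2c² · 2∫₀ᵗ (t-s) K_J(s) ds + 8 ∫ (W - m)² dμ_T`,
`K_g(s) = ∫ g · P_s g dμ_T`: the dictionary `2∫₀ᵗ(t-s)K_g = E[(∫₀ᵗ g(z_s))²]`, the pointwise inequality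
`(cA + B - D)² ≤ 2c²A² + 4B² + 4D²`, and stationarity `E (W(z_r) - m)² = ∫ (W - m)² dμ_T` at `r = t, 0`. [folklore] -/
theorem pinnedChain_heatVar_le_of_pathwise_split {f J W : PhaseSpace N → ℝ} (hfm : Measurable f)
    (hJm : Measurable J) (hWm : Measurable W)
    (hf2 : Integrable (fun y => f y ^ 2) ((pinnedChain ω₂ lam β γ).gibbsMeasure N T))
    (hJ2 : Integrable (fun y => J y ^ 2) ((pinnedChain ω₂ lam β γ).gibbsMeasure N T))
    (hW2 : Integrable (fun y => W y ^ 2) ((pinnedChain ω₂ lam β γ).gibbsMeasure N T))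
    (c : ℝ) {t : ℝ} (ht : 0 ≤ t)
    (hsplit : ∀ (x : PhaseSpace N) (w : WienerPair),
      ∫ s in (0 : ℝ)..t, f ((pinnedChain ω₂ lam β γ).solMap N T T s x (pairPath w)) =
        c * (∫ s in (0 : ℝ)..t, J ((pinnedChain ω₂ lam β γ).solMap N T T s x (pairPath w))) +
          (W ((pinnedChain ω₂ lam β γ).solMap N T T t x (pairPath w)) - W x))
    (m : ℝ) :
    2 * ∫ s in (0 : ℝ)..t, (t - s) * ∫ z, f z * (∫ y, f y ∂((pinnedChain ω₂ lam β γ).transitionKernel N T T s.toNNReal z))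
        ∂((pinnedChain ω₂ lam β γ).gibbsMeasure N T) ≤
      2 * c ^ 2 * (2 * ∫ s in (0 : ℝ)..t, (t - s) *
          ∫ z, J z * (∫ y, J y ∂((pinnedChain ω₂ lam β γ).transitionKernel N T T s.toNNReal z))
            ∂((pinnedChain ω₂ lam β γ).gibbsMeasure N T)) +
        8 * ∫ z, (W z - m) ^ 2 ∂((pinnedChain ω₂ lam β γ).gibbsMeasure N T) := by
  set P := pinnedChain ω₂ lam β γ with hP
  set μ := P.gibbsMeasure N T with hμ
  have hinv : ∀ s : ℝ≥0, μ.bind (P.transitionKernel N T T s) = μ := fun s =>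
    pinnedChain_gibbsMeasure_bind_transitionKernel hω hl hβ.le hγ.le hN hT s
  haveI : IsProbabilityMeasure μ := pinnedChain_isProbabilityMeasure_gibbsMeasure hω hl hβ.le γ N hT
  -- the dictionary `2∫₀ᵗ(t-s)K_g = E[(∫₀ᵗ g(z_s))²]`
  have Vf := pinnedChain_integral_sq_intervalIntegral_of_invariant hω hl hβ.le hγ.le N T T μ hinv hfm hf2 ht
  have VJ := pinnedChain_integral_sq_intervalIntegral_of_invariant hω hl hβ.le hγ.le N T T μ hinv hJm hJ2 ht
  rw [← Vf, ← VJ]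
  -- integrability of the pieces
  have hWm' : Measurable fun y => W y - m := hWm.sub measurable_const
  have hW2' : Integrable (fun y => (W y - m) ^ 2) μ := by
    have h2 : Integrable (fun y => 2 * W y ^ 2 + 2 * m ^ 2) μ := (hW2.const_mul 2).add (integrable_const _)
    refine h2.mono' (hWm'.pow_const 2).aestronglyMeasurable (Eventually.of_forall fun y => ?_)
    rw [Real.norm_eq_abs, abs_of_nonneg (sq_nonneg _)]
    nlinarith [sq_nonneg (W y + m)]
  obtain ⟨iWt, eWt⟩ := pinnedChain_integrable_sq_solMap_of_invariant hω hl hβ.le hγ.le N T T μ hinv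
    (f := fun y => W y - m) hW2' t
  obtain ⟨iW0, eW0⟩ := pinnedChain_integrable_sq_solMap_of_invariant hω hl hβ.le hγ.le N T T μ hinv
    (f := fun y => W y - m) hW2' 0
  have iJJ := (pinnedChain_integrable_intervalIntegral_mul_of_invariant hω hl hβ.le hγ.le N T T μ hinv hJm hJm hJ2 hJ2
    ht).congr (Eventually.of_forall fun p => (sq _).symm)
  have iff' := (pinnedChain_integrable_intervalIntegral_mul_of_invariant hω hl hβ.le hγ.le N T T μ hinv hfm hfm hf2
    hf2 ht).congr (Eventually.of_forall fun p => (sq _).symm)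
  -- `z_0 = x`
  have h0 : ∀ p : PhaseSpace N × WienerPair, P.solMap N T T 0 p.1 (pairPath p.2) = p.1 := fun p =>
    pinnedChain_solMap_of_nonpos N T T p.1 (pairPath p.2) le_rfl
  -- the pointwise inequality
  have hpt : ∀ p : PhaseSpace N × WienerPair,
      (∫ s in (0 : ℝ)..t, f (P.solMap N T T s p.1 (pairPath p.2))) ^ 2 ≤
        2 * c ^ 2 * (∫ s in (0 : ℝ)..t, J (P.solMap N T T s p.1 (pairPath p.2))) ^ 2 +
          4 * (W (P.solMap N T T t p.1 (pairPath p.2)) - m) ^ 2 +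
          4 * (W (P.solMap N T T 0 p.1 (pairPath p.2)) - m) ^ 2 := by
    intro p
    rw [hsplit p.1 p.2, h0 p]
    nlinarith [sq_nonneg (c * (∫ s in (0 : ℝ)..t, J (P.solMap N T T s p.1 (pairPath p.2))) -
        (W (P.solMap N T T t p.1 (pairPath p.2)) - W p.1)),
      sq_nonneg ((W (P.solMap N T T t p.1 (pairPath p.2)) - m) + (W p.1 - m))]
  -- integrate
  have i1 : Integrable (fun p : PhaseSpace N × WienerPair =>
      2 * c ^ 2 * (∫ s in (0 : ℝ)..t, J (P.solMap N T T s p.1 (pairPath p.2))) ^ 2) (μ.prod wienerPair) :=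
    iJJ.const_mul _
  have i2 : Integrable (fun p : PhaseSpace N × WienerPair =>
      4 * (W (P.solMap N T T t p.1 (pairPath p.2)) - m) ^ 2) (μ.prod wienerPair) := iWt.const_mul _
  have i3 : Integrable (fun p : PhaseSpace N × WienerPair =>
      4 * (W (P.solMap N T T 0 p.1 (pairPath p.2)) - m) ^ 2) (μ.prod wienerPair) := iW0.const_mul _
  have i12 : Integrable (fun p : PhaseSpace N × WienerPair =>
      2 * c ^ 2 * (∫ s in (0 : ℝ)..t, J (P.solMap N T T s p.1 (pairPath p.2))) ^ 2 +
        4 * (W (P.solMap N T T t p.1 (pairPath p.2)) - m) ^ 2) (μ.prod wienerPair) := i1.add i2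
  have hR : Integrable (fun p : PhaseSpace N × WienerPair =>
      2 * c ^ 2 * (∫ s in (0 : ℝ)..t, J (P.solMap N T T s p.1 (pairPath p.2))) ^ 2 +
        4 * (W (P.solMap N T T t p.1 (pairPath p.2)) - m) ^ 2 +
        4 * (W (P.solMap N T T 0 p.1 (pairPath p.2)) - m) ^ 2) (μ.prod wienerPair) := i12.add i3
  have hmono := integral_mono iff' hR hpt
  have hRHS : ∫ p : PhaseSpace N × WienerPair,
      (2 * c ^ 2 * (∫ s in (0 : ℝ)..t, J (P.solMap N T T s p.1 (pairPath p.2))) ^ 2 +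
        4 * (W (P.solMap N T T t p.1 (pairPath p.2)) - m) ^ 2 +
        4 * (W (P.solMap N T T 0 p.1 (pairPath p.2)) - m) ^ 2) ∂(μ.prod wienerPair) =
      2 * c ^ 2 * ∫ p : PhaseSpace N × WienerPair,
          (∫ s in (0 : ℝ)..t, J (P.solMap N T T s p.1 (pairPath p.2))) ^ 2 ∂(μ.prod wienerPair) +
        4 * ∫ y, (W y - m) ^ 2 ∂μ + 4 * ∫ y, (W y - m) ^ 2 ∂μ := by
    rw [MeasureTheory.integral_add i12 i3, MeasureTheory.integral_add i1 i2, MeasureTheory.integral_const_mul,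
      MeasureTheory.integral_const_mul, MeasureTheory.integral_const_mul, eWt, eW0]
  rw [hRHS] at hmono
  linarith [hmono]

end Generic

/-! ### The objects of the tent reduction are honest -/

section Objects

variable {ω₂ lam β γ : ℝ} (hω : 0 < ω₂) (hl : 0 ≤ lam) (hβ : 0 < β) (hγ : 0 < γ) {N : ℕ} (hN : 0 < N)
  {T : ℝ} (hT : 0 < T)
include hω hl hβ hγ hN hT

omit hω hl hβ hγ hN hT in
/-- The block current `J = ∑_{b₀ ≤ k ≤ b₀+L} j_k` is continuous. [folklore] -/
theorem continuous_blockSum (b₀ L : ℕ) :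
    Continuous fun z : PhaseSpace N => ∑ k : Fin N,
      (if b₀ ≤ k.val ∧ k.val ≤ b₀ + L then (pinnedChain ω₂ lam β γ).bondCurrent N k z else 0) := by
  refine continuous_finsetSum _ fun k _ => ?_
  split_ifs
  · exact pinnedChain_continuous_bondCurrent ω₂ lam β γ N k
  · exact continuous_const

omit hγ hN hT in
/-- `|J| ≤ N · M_N(ϑ) e^{ϑH}` for the block current, `ϑ > 0` (each `|j_k| ≤ M_N(ϑ) e^{ϑH}`). [folklore] -/
theorem abs_blockSum_le_exp (b₀ L : ℕ) {ϑ : ℝ} (hϑ : 0 < ϑ) (z : PhaseSpace N) :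
    |∑ k : Fin N, (if b₀ ≤ k.val ∧ k.val ≤ b₀ + L then (pinnedChain ω₂ lam β γ).bondCurrent N k z else 0)| ≤
      (N * (N * ((3 + β) / 2) * (2 * Real.exp ϑ / ϑ ^ 2))) *
        Real.exp (ϑ * (pinnedChain ω₂ lam β γ).hamiltonian N z) := by
  have hterm : ∀ k : Fin N, |(if b₀ ≤ k.val ∧ k.val ≤ b₀ + L then (pinnedChain ω₂ lam β γ).bondCurrent N k z else 0)| ≤
      (N * ((3 + β) / 2) * (2 * Real.exp ϑ / ϑ ^ 2)) * Real.exp (ϑ * (pinnedChain ω₂ lam β γ).hamiltonian N z) := by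
    intro k
    split_ifs
    · exact pinnedChain_abs_bondCurrent_le_exp hω.le hl hβ.le γ N hϑ k z
    · rw [abs_zero]; positivity
  calc _ ≤ ∑ k : Fin N, |(if b₀ ≤ k.val ∧ k.val ≤ b₀ + L then (pinnedChain ω₂ lam β γ).bondCurrent N k z else 0)| :=
        Finset.abs_sum_le_sum_abs _ _
    _ ≤ ∑ _k : Fin N, (N * ((3 + β) / 2) * (2 * Real.exp ϑ / ϑ ^ 2)) *
          Real.exp (ϑ * (pinnedChain ω₂ lam β γ).hamiltonian N z) := Finset.sum_le_sum fun k _ => hterm k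
    _ = _ := by simp [Finset.sum_const, Finset.card_univ, Fintype.card_fin]; ring

/-- **`⟨J²⟩_T < ∞`** for the block current. [folklore] -/
theorem pinnedChain_integrable_sq_blockSum (b₀ L : ℕ) :
    Integrable (fun z => (∑ k : Fin N, (if b₀ ≤ k.val ∧ k.val ≤ b₀ + L then
        (pinnedChain ω₂ lam β γ).bondCurrent N k z else 0)) ^ 2) ((pinnedChain ω₂ lam β γ).gibbsMeasure N T) :=
  (pinnedChain_integral_sq_act_le hω hl hβ hγ hN hT (quarter_inv_temp_admissible hT).1
    (quarter_inv_temp_admissible hT).2 (continuous_blockSum b₀ L)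
    (abs_blockSum_le_exp hω hl hβ b₀ L (quarter_inv_temp_admissible hT).1) 0).1

omit hγ hN hT in
/-- `|W_w| ≤ (2e^ϑ/ϑ²) e^{ϑH}` for the tent-weighted energy (`0 ≤ w ≤ 1`, so `|W_w| ≤ H ≤ (1+H)²`), `ϑ > 0`.
[folklore] -/
theorem abs_tentEnergy_le_exp (b₀ L : ℕ) {ϑ : ℝ} (hϑ : 0 < ϑ) (z : PhaseSpace N) :
    |weightedEnergy (pinnedChain ω₂ lam β γ)
        (fun k : ℕ => if b₀ < k ∧ k ≤ b₀ + L then ((b₀ : ℝ) + L + 1 - k) / (L + 1) else 0) N z| ≤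
      (2 * Real.exp ϑ / ϑ ^ 2) * Real.exp (ϑ * (pinnedChain ω₂ lam β γ).hamiltonian N z) := by
  have hw : ∀ k : ℕ, |(fun k : ℕ => if b₀ < k ∧ k ≤ b₀ + L then ((b₀ : ℝ) + L + 1 - k) / (L + 1) else 0) k| ≤ 1 := by
    intro k
    simp only
    split_ifs with h
    · have hL : (0 : ℝ) < (L : ℝ) + 1 := by positivity
      rw [abs_le]
      constructor
      · rw [le_div_iff₀ hL]
        have : (k : ℝ) ≤ (b₀ : ℝ) + L := by exact_mod_cast h.2
        linarith
      · rw [div_le_iff₀ hL]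
        have : (b₀ : ℝ) + 1 ≤ (k : ℝ) := by exact_mod_cast h.1
        linarith
    · simp
  have h1 := Summit.AtomisticToContinuum.FouriersLaw.Theorems.SubBallisticWindow.RampCorrector.abs_weightedEnergy_le
    hω.le hl hβ.le γ hw z
  have hH0 := pinnedChain_hamiltonian_nonneg hω.le hl hβ.le γ N z
  have hsq := one_add_sq_le_exp hH0 hϑ
  calc _ ≤ 1 * (pinnedChain ω₂ lam β γ).hamiltonian N z := h1
    _ ≤ (1 + (pinnedChain ω₂ lam β γ).hamiltonian N z) ^ 2 := by nlinarith
    _ ≤ _ := hsq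

omit hω hl hβ hγ hN hT in
/-- The tent-weighted energy is continuous. [folklore] -/
theorem continuous_tentEnergy (b₀ L : ℕ) :
    Continuous (weightedEnergy (pinnedChain ω₂ lam β γ)
      (fun k : ℕ => if b₀ < k ∧ k ≤ b₀ + L then ((b₀ : ℝ) + L + 1 - k) / (L + 1) else 0) N) :=
  (contDiff_weightedEnergy (pinnedChain ω₂ lam β γ) (pinnedChain_contDiff_U ω₂ lam β γ (n := 0))
    (pinnedChain_contDiff_V ω₂ lam β γ (n := 0)) _ N).continuous

/-- **`⟨W_w²⟩_T < ∞`** for the tent-weighted energy. [folklore] -/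
theorem pinnedChain_integrable_sq_tentEnergy (b₀ L : ℕ) :
    Integrable (fun z => (weightedEnergy (pinnedChain ω₂ lam β γ)
        (fun k : ℕ => if b₀ < k ∧ k ≤ b₀ + L then ((b₀ : ℝ) + L + 1 - k) / (L + 1) else 0) N z) ^ 2)
      ((pinnedChain ω₂ lam β γ).gibbsMeasure N T) :=
  (pinnedChain_integral_sq_act_le hω hl hβ hγ hN hT (quarter_inv_temp_admissible hT).1
    (quarter_inv_temp_admissible hT).2 (continuous_tentEnergy b₀ L)
    (abs_tentEnergy_le_exp hω hl hβ b₀ L (quarter_inv_temp_admissible hT).1) 0).1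

end Objects

/-! ### The tent reduction of the bond-heat variance -/

/-- **The tent (block-averaging) reduction of the single-bond heat variance, at the kernel level.**  For the pinned
anharmonic chain (`ω₂ > 0`, `lam ≥ 0`, `β, γ > 0`), `T > 0`, a bond `b₀` and a block length `L` with `b₀ + L + 1 < N`
(so the `L` sites to the right of bond `b₀` are interior), every `t ≥ 0` and every centring constant `m`:

  `V_N(b₀, t) ≤ (2/(L+1)²) · V_N^J(t) + 8 ∫ (W - m)² dμ_T`,

where `V_N(b₀,t) = 2∫₀ᵗ (t-s) ∫ j_{b₀} · P_s j_{b₀} dμ_T ds` is the bond-heat variance functional of the route items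
(S)/(S_lc) (kernel `transitionKernel N T T`, Gibbs measure `gibbsMeasure N T`), `V_N^J(t) = 2∫₀ᵗ (t-s) ∫ J · P_s J dμ_T ds`
the same functional of the BLOCK current `J = ∑_{b₀ ≤ k ≤ b₀+L} j_k` (`= E[(∫₀ᵗ J(z_s) ds)²] ≥ 0`), and `W = W_w` the
tent-weighted site energy (`weightedEnergy`, weights `w_k = (b₀+L+1-k)/(L+1)` on `b₀ < k ≤ b₀+L`).  Proof: the pathwise
tent splitting `∫₀ᵗ j_{b₀} = (L+1)⁻¹ ∫₀ᵗ J + ΔW` (`pinnedChain_bondHeat_tent_split`) squared and integrated against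
`μ_T ⊗ W` (`pinnedChain_heatVar_le_of_pathwise_split`).  This is the exact form of the heuristic "heat through one bond
= block-averaged heat + change of the energy stored in between": an `N`-uniform window law for `V_N(b₀,·)` follows
from (a) an `N`-uniform bound `inf_m ∫ (W - m)² dμ_T = O(L)` (statics of the 1-D Gibbs state) and (b) an `N`-uniform
bound on the block functional `V_N^J(t) ≤ 2t ∫₀ᵗ |∫ J · P_s J dμ_T| ds` (dynamical decorrelation of the block current),
optimised in `L`. [folklore] -/
theorem pinnedChain_bondHeatVar_le_tent {ω₂ lam β γ : ℝ} (hω : 0 < ω₂) (hl : 0 ≤ lam) (hβ : 0 < β) (hγ : 0 < γ)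
    {N : ℕ} {T : ℝ} (hT : 0 < T) {b₀ L : ℕ} (hbL : b₀ + L + 1 < N) {t : ℝ} (ht : 0 ≤ t) (m : ℝ) :
    2 * ∫ s in (0 : ℝ)..t, (t - s) * ∫ z, (pinnedChain ω₂ lam β γ).bondCurrent N ⟨b₀, by omega⟩ z *
        (∫ y, (pinnedChain ω₂ lam β γ).bondCurrent N ⟨b₀, by omega⟩ y
          ∂((pinnedChain ω₂ lam β γ).transitionKernel N T T s.toNNReal z))
        ∂((pinnedChain ω₂ lam β γ).gibbsMeasure N T) ≤
      2 / ((L : ℝ) + 1) ^ 2 * (2 * ∫ s in (0 : ℝ)..t, (t - s) *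
          ∫ z, (∑ k : Fin N, (if b₀ ≤ k.val ∧ k.val ≤ b₀ + L then (pinnedChain ω₂ lam β γ).bondCurrent N k z else 0)) *
            (∫ y, (∑ k : Fin N, (if b₀ ≤ k.val ∧ k.val ≤ b₀ + L then (pinnedChain ω₂ lam β γ).bondCurrent N k y else 0))
              ∂((pinnedChain ω₂ lam β γ).transitionKernel N T T s.toNNReal z))
            ∂((pinnedChain ω₂ lam β γ).gibbsMeasure N T)) +
        8 * ∫ z, (weightedEnergy (pinnedChain ω₂ lam β γ)
            (fun k : ℕ => if b₀ < k ∧ k ≤ b₀ + L then ((b₀ : ℝ) + L + 1 - k) / (L + 1) else 0) N z - m) ^ 2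
          ∂((pinnedChain ω₂ lam β γ).gibbsMeasure N T) := by
  have hN : 0 < N := by omega
  have hL : (0 : ℝ) < (L : ℝ) + 1 := by positivity
  have key := pinnedChain_heatVar_le_of_pathwise_split hω hl hβ hγ hN hT
    (f := (pinnedChain ω₂ lam β γ).bondCurrent N ⟨b₀, by omega⟩)
    (J := fun z => ∑ k : Fin N, (if b₀ ≤ k.val ∧ k.val ≤ b₀ + L then (pinnedChain ω₂ lam β γ).bondCurrent N k z else 0))
    (W := weightedEnergy (pinnedChain ω₂ lam β γ)
      (fun k : ℕ => if b₀ < k ∧ k ≤ b₀ + L then ((b₀ : ℝ) + L + 1 - k) / (L + 1) else 0) N)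
    (pinnedChain_continuous_bondCurrent ω₂ lam β γ N _).measurable (continuous_blockSum b₀ L).measurable
    (continuous_tentEnergy b₀ L).measurable (pinnedChain_integrable_sq_bondCurrent hω hl hβ hγ hN hT _)
    (pinnedChain_integrable_sq_blockSum hω hl hβ hγ hN hT b₀ L) (pinnedChain_integrable_sq_tentEnergy hω hl hβ hγ hN hT b₀ L)
    (1 / ((L : ℝ) + 1)) ht
    (fun x w => pinnedChain_bondHeat_tent_split hω hl hβ.le hγ.le T T hbL x (pairPath w) ht) m
  have e : 2 * (1 / ((L : ℝ) + 1)) ^ 2 = 2 / ((L : ℝ) + 1) ^ 2 := by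
    field_simp
  rw [e] at key
  exact key


/-- **Tent reduction with the absolute block Green–Kubo integral.**  Same setting as `pinnedChain_bondHeatVar_le_tent`;
bounding `(t - s) K_J(s) ≤ t |K_J(s)|` on `[0, t]` (`K_J(s) = ∫ J · P_s J dμ_T`, continuous in `s`) gives, for every
`t ≥ 0` and `m`,

  `V_N(b₀, t) ≤ (4t/(L+1)²) ∫₀ᵗ |K_J(s)| ds + 8 ∫ (W - m)² dμ_T`.

So an `N`-uniform window law `V_N(b₀,t) ≤ B t^θ` (`θ < 1`, cf. `…LightConeBondHeatWindowedTransfer`) follows from two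
`N`-uniform inputs at a bulk bond: STATICS `inf_m ∫ (W - m)² dμ_T ≤ c·L` (extensive fluctuations of the tent energy in
the 1-D Gibbs state) and DYNAMICS `∫₀ᵗ |K_J(s)| ds ≤ (L+1)·k(t)` with `k(t) = O(t^{1-δ})` (absolute time-decorrelation
of the block current per unit length); the choice `L + 1 ≍ √(t k(t)/c)` then gives `V_N(b₀,t) = O(√(c t k(t)))`, i.e.
`θ = 1 - δ/2` — and the Edwards–Wilkinson `√t` exactly when `k` is bounded. [folklore] -/
theorem pinnedChain_bondHeatVar_le_tent_abs {ω₂ lam β γ : ℝ} (hω : 0 < ω₂) (hl : 0 ≤ lam) (hβ : 0 < β) (hγ : 0 < γ)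
    {N : ℕ} {T : ℝ} (hT : 0 < T) {b₀ L : ℕ} (hbL : b₀ + L + 1 < N) {t : ℝ} (ht : 0 ≤ t) (m : ℝ) :
    2 * ∫ s in (0 : ℝ)..t, (t - s) * ∫ z, (pinnedChain ω₂ lam β γ).bondCurrent N ⟨b₀, by omega⟩ z *
        (∫ y, (pinnedChain ω₂ lam β γ).bondCurrent N ⟨b₀, by omega⟩ y
          ∂((pinnedChain ω₂ lam β γ).transitionKernel N T T s.toNNReal z))
        ∂((pinnedChain ω₂ lam β γ).gibbsMeasure N T) ≤
      4 * t / ((L : ℝ) + 1) ^ 2 * (∫ s in (0 : ℝ)..t,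
          |∫ z, (∑ k : Fin N, (if b₀ ≤ k.val ∧ k.val ≤ b₀ + L then (pinnedChain ω₂ lam β γ).bondCurrent N k z else 0)) *
            (∫ y, (∑ k : Fin N, (if b₀ ≤ k.val ∧ k.val ≤ b₀ + L then (pinnedChain ω₂ lam β γ).bondCurrent N k y else 0))
              ∂((pinnedChain ω₂ lam β γ).transitionKernel N T T s.toNNReal z))
            ∂((pinnedChain ω₂ lam β γ).gibbsMeasure N T)|) +
        8 * ∫ z, (weightedEnergy (pinnedChain ω₂ lam β γ)
            (fun k : ℕ => if b₀ < k ∧ k ≤ b₀ + L then ((b₀ : ℝ) + L + 1 - k) / (L + 1) else 0) N z - m) ^ 2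
          ∂((pinnedChain ω₂ lam β γ).gibbsMeasure N T) := by
  have hN : 0 < N := by omega
  have hL : (0 : ℝ) < (L : ℝ) + 1 := by positivity
  have key := pinnedChain_bondHeatVar_le_tent hω hl hβ hγ hT hbL ht m
  -- `K_J` is continuous in `s`
  set K : ℝ → ℝ := fun s => ∫ z, (∑ k : Fin N, (if b₀ ≤ k.val ∧ k.val ≤ b₀ + L then
      (pinnedChain ω₂ lam β γ).bondCurrent N k z else 0)) *
    (∫ y, (∑ k : Fin N, (if b₀ ≤ k.val ∧ k.val ≤ b₀ + L then (pinnedChain ω₂ lam β γ).bondCurrent N k y else 0))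
      ∂((pinnedChain ω₂ lam β γ).transitionKernel N T T s.toNNReal z))
    ∂((pinnedChain ω₂ lam β γ).gibbsMeasure N T) with hK
  have hKc : Continuous K :=
    pinnedChain_continuous_autocorr hω hl hβ hγ hN hT (quarter_inv_temp_admissible hT).1
      (quarter_inv_temp_admissible hT).2 (continuous_blockSum b₀ L)
      (abs_blockSum_le_exp hω hl hβ b₀ L (quarter_inv_temp_admissible hT).1)
  -- `∫₀ᵗ (t-s) K ≤ t ∫₀ᵗ |K|`
  have h1 : ∫ s in (0 : ℝ)..t, (t - s) * K s ≤ ∫ s in (0 : ℝ)..t, t * |K s| := by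
    refine intervalIntegral.integral_mono_on ht
      (((continuous_const.sub continuous_id).mul hKc).intervalIntegrable _ _)
      ((continuous_const.mul hKc.abs).intervalIntegrable _ _) fun s hs => ?_
    calc (t - s) * K s ≤ |(t - s) * K s| := le_abs_self _
      _ = |t - s| * |K s| := abs_mul _ _
      _ ≤ t * |K s| := by
          refine mul_le_mul_of_nonneg_right ?_ (abs_nonneg _)
          rw [abs_le]; constructor <;> linarith [hs.1, hs.2]
  rw [intervalIntegral.integral_const_mul] at h1
  have h2 : 2 / ((L : ℝ) + 1) ^ 2 * (2 * ∫ s in (0 : ℝ)..t, (t - s) * K s) ≤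
      4 * t / ((L : ℝ) + 1) ^ 2 * ∫ s in (0 : ℝ)..t, |K s| := by
    have hc : 0 ≤ 2 / ((L : ℝ) + 1) ^ 2 := by positivity
    calc 2 / ((L : ℝ) + 1) ^ 2 * (2 * ∫ s in (0 : ℝ)..t, (t - s) * K s)
        ≤ 2 / ((L : ℝ) + 1) ^ 2 * (2 * (t * ∫ s in (0 : ℝ)..t, |K s|)) :=
          mul_le_mul_of_nonneg_left (by linarith) hc
      _ = 4 * t / ((L : ℝ) + 1) ^ 2 * ∫ s in (0 : ℝ)..t, |K s| := by ring
  exact key.trans (by linarith [h2])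


end Summit.AtomisticToContinuum.FouriersLaw.Theorems.LightConeBondHeat

end
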